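import Mathlib
import Summits.Ventures.PercRepro2.OneEdge
import Summits.Ventures.PercRepro2.TriDisagreementPinned
import Summits.Ventures.PercRepro2.HCovCubic

/-!
# One typed edge never contributes (blind cell PercRepro2, night-3, 2026-08-23)

For the kernel `K₃` of the covariance form (HCOV) the typed three-copy count with a SINGLE typed
edge vanishes: `typedCount {e} z τ K₃ = 0` for every pinned `z`, every `e` and both types
(row 2′TRI / ADDENDUM 22: the tensor-Bernstein coefficient `b_k` is `0` whenever exactly one edge
is typed).  Weighted corollary `Gc_eq_zero_of_one_fractional`: `Gc = D · P(Q) · G` is identically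
`0` on every edge line through a deterministic weight vector.  Proof: `typedCount_singleton` (three
kernel values at `(z⁺, z⁻, z⁻)` and permutations), `K3_eq_KB` (the kernel depends only on the STATE:
`Q`, and which of `o, b, a₃` lie in `C(a₁)` / `C(a₂)`), `OneEdge.conn_update_true_cases` (opening one
edge kills `Q` or grows ONE root cluster by neither-vertices) and `merge_identity` (`decide`).
-/

namespace Summit.Ventures.PercRepro2

open UnionCluster

namespace CovForm

namespace OneTyped

/-! ## The typed count with one typed edge -/

section SumLemma

variable {E : Type*} [Fintype E] [DecidableEq E] {R : Type*} [CommRing R]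

omit [Fintype E] in
/-- Agreeing with `z` off `e` means being `z` updated at `e`. -/
lemma agree_off_singleton_iff (z x : Config E) (e : E) :
    (∀ e', ¬ e' = e → x e' = z e') ↔ x = Function.update z e (x e) := by
  constructor
  · intro h
    funext e'
    by_cases he : e' = e
    · subst he; simp
    · rw [Function.update_of_ne he]
      exact h e' he
  · intro h e' he'
    conv_lhs => rw [h]
    rw [Function.update_of_ne he']

/-- A constant condition commutes with a sum. -/
lemma sum_ite_const {ι : Type*} (s : Finset ι) (A : Prop) [Decidable A] (f : ι → R) :
    (∑ i ∈ s, if A then f i else 0) = if A then (∑ i ∈ s, f i) else 0 := by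
  by_cases hA : A <;> simp [hA]

/-- Summing a function over the configurations agreeing with `z` off `e`. -/
lemma sum_agree_off_singleton (z : Config E) (e : E) (P : Config E → Prop) [DecidablePred P]
    (hP : ∀ x, P x ↔ x = Function.update z e (x e)) (φ : Config E → R) :
    (∑ x : Config E, if P x then φ x else 0) = ∑ c : Bool, φ (Function.update z e c) := by
  rw [← Finset.sum_filter]
  have hset : (Finset.univ.filter P) = {Function.update z e false, Function.update z e true} := by
    ext x
    simp only [Finset.mem_filter, Finset.mem_univ, true_and, Finset.mem_insert,
      Finset.mem_singleton, hP]
    constructor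
    · intro h
      cases hxe : x e
      · left; rw [hxe] at h; exact h
      · right; rw [hxe] at h; exact h
    · rintro (h | h)
      · rw [h]; simp
      · rw [h]; simp
  rw [hset, Finset.sum_pair, Fintype.sum_bool, add_comm]
  intro h
  have := congrArg (fun f => f e) h
  simp at this

/-- **One typed edge**: the typed count over `F = {e}` is the sum over the eight
`(z[e ↦ c₁], z[e ↦ c₂], z[e ↦ c₃])` with the prescribed open count. -/
theorem typedCount_singleton (z : Config E) (e : E) (τ : E → ℕ)
    (K : Config E → Config E → Config E → R) :
    typedCount {e} z τ K =
      ∑ c₁ : Bool, ∑ c₂ : Bool, ∑ c₃ : Bool,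
        if c₁.toNat + c₂.toNat + c₃.toNat = τ e then
          K (Function.update z e c₁) (Function.update z e c₂) (Function.update z e c₃) else 0 := by
  unfold typedCount
  have hcond : ∀ x y w : Config E,
      ((∀ e', e' ∉ ({e} : Finset E) → x e' = z e' ∧ y e' = z e' ∧ w e' = z e') ∧
        (∀ e' ∈ ({e} : Finset E), openCount x y w e' = τ e')) ↔
      (x = Function.update z e (x e) ∧ (y = Function.update z e (y e) ∧
        (w = Function.update z e (w e) ∧ openCount x y w e = τ e))) := by
    intro x y w
    simp only [Finset.mem_singleton, forall_eq, imp_and, forall_and]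
    rw [agree_off_singleton_iff, agree_off_singleton_iff, agree_off_singleton_iff]
    tauto
  simp only [hcond, sum_ite_const, ite_and]
  rw [sum_agree_off_singleton z e _ (fun x => Iff.rfl)]
  refine Finset.sum_congr rfl fun c₁ _ => ?_
  rw [sum_agree_off_singleton z e _ (fun x => Iff.rfl)]
  refine Finset.sum_congr rfl fun c₂ _ => ?_
  rw [sum_agree_off_singleton z e _ (fun x => Iff.rfl)]
  refine Finset.sum_congr rfl fun c₃ _ => ?_
  simp only [openCount, Function.update_self]

end SumLemma

/-! ## States and the kernel on states -/

section States

/-- The state of a configuration for the kernel `K₃`: `(q', Lo, Ho, Lb, Hb, L3, H3)` — whether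
`a₂ ↔ a₁` (so `Q` FAILS) and, for each of `o, b, a₃`, whether it lies in `C(a₁)` / in `C(a₂)`. -/
abbrev St := Bool × Bool × Bool × Bool × Bool × Bool × Bool

namespace St
/-- `Q` fails. -/
def q' (s : St) : Bool := s.1
/-- `o ∈ C(a₁)`. -/
def Lo (s : St) : Bool := s.2.1
/-- `o ∈ C(a₂)`. -/
def Ho (s : St) : Bool := s.2.2.1
/-- `b ∈ C(a₁)`. -/
def Lb (s : St) : Bool := s.2.2.2.1
/-- `b ∈ C(a₂)`. -/
def Hb (s : St) : Bool := s.2.2.2.2.1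
/-- `a₃ ∈ C(a₁)`. -/
def L3 (s : St) : Bool := s.2.2.2.2.2.1
/-- `a₃ ∈ C(a₂)`. -/
def H3 (s : St) : Bool := s.2.2.2.2.2.2
end St

/-- `1_Q` on states. -/
def qB (s : St) : ℤ := if s.q' then 0 else 1
/-- `1_PD` on states. -/
def pdB (s : St) : ℤ := if s.q' then 0 else if s.L3 || s.H3 then 0 else 1
/-- `σ_v` on states. -/
def sigB (L H : Bool) : ℤ := (if L then 1 else 0) - (if H then 1 else 0)
/-- `1_{v ∈ U}` on states. -/
def uB (L H : Bool) : ℤ := (if L then 1 else 0) + (if H then 1 else 0)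

/-- The kernel `K₃` on states (the same eight terms as `K3`). -/
def KB (x y z : St) : ℤ :=
  pdB x * (qB y * (qB z * (sigB z.Lo z.Ho * sigB z.Lb z.Hb)))
  + qB x * ((pdB y * uB y.Lo y.Ho) * (qB z * (sigB z.L3 z.H3 * sigB z.Lb z.Hb)))
  - pdB x * (qB y * (qB z * (sigB z.L3 z.H3 * (uB z.Lo z.Ho * sigB z.Lb z.Hb))))
  - pdB x * ((qB y * sigB y.Lb y.Hb) * (qB z * sigB z.Lo z.Ho))
  - (pdB x * uB x.Lo x.Ho) * ((qB y * sigB y.Lb y.Hb) * (qB z * sigB z.L3 z.H3))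
  + pdB x * ((qB y * sigB y.Lb y.Hb) * (qB z * (sigB z.L3 z.H3 * uB z.Lo z.Ho)))
  - pdB x * (qB y * (pdB z * (uB z.Lo z.Ho * uB z.Lb z.Hb)))
  + qB x * ((pdB y * uB y.Lb y.Hb) * (pdB z * uB z.Lo z.Ho))

/-- If a state fails `Q`, every kernel value involving it vanishes. -/
theorem KB_eq_zero_of_q' (x y z : St) (h : x.q' = true ∨ y.q' = true ∨ z.q' = true) :
    KB x y z = 0 := by
  rcases h with h | h | h <;> simp [KB, qB, pdB, h]

/-- The one-sided merge relation (as a Boolean test): both states satisfy `Q`, are consistent, and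
`t` is `s` with ONE root cluster grown by vertices that were in neither cluster. -/
def relB (s t : St) : Bool :=
  !s.q' && !t.q' &&
  (!s.Lo || !s.Ho) && (!s.Lb || !s.Hb) && (!s.L3 || !s.H3) &&
  (!t.Lo || !t.Ho) && (!t.Lb || !t.Hb) && (!t.L3 || !t.H3) &&
  ((t.Ho == s.Ho && t.Hb == s.Hb && t.H3 == s.H3 &&
      (!s.Lo || t.Lo) && (!s.Lb || t.Lb) && (!s.L3 || t.L3) &&
      (!t.Lo || s.Lo || !s.Ho) && (!t.Lb || s.Lb || !s.Hb) && (!t.L3 || s.L3 || !s.H3)) ||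
    (t.Lo == s.Lo && t.Lb == s.Lb && t.L3 == s.L3 &&
      (!s.Ho || t.Ho) && (!s.Hb || t.Hb) && (!s.H3 || t.H3) &&
      (!t.Ho || s.Ho || !s.Lo) && (!t.Hb || s.Hb || !s.Lb) && (!t.H3 || s.H3 || !s.L3)))

/-- **The one-merge identity**: along a one-sided merge `s → t` the two three-term typed sums of
the kernel vanish. -/
theorem merge_identity (s t : St) (h : relB s t = true) :
    KB t s s + KB s t s + KB s s t = 0 ∧ KB s t t + KB t s t + KB t t s = 0 := by
  revert s t
  decide +kernel

end States

/-! ## The bridge: `K₃` depends only on the states -/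

section Bridge

open Classical

variable {V : Type*} {E : Type*} [Fintype E] [DecidableEq E] {R : Type*} [Field R]

/-- The state of a configuration. -/
noncomputable def st (ends : E → Sym2 V) (o a₁ a₂ a₃ b : V) (ω : Config E) : St :=
  (decide (Conn ends ω a₂ a₁), decide (Conn ends ω a₁ o), decide (Conn ends ω a₂ o),
    decide (Conn ends ω a₁ b), decide (Conn ends ω a₂ b), decide (Conn ends ω a₁ a₃),
    decide (Conn ends ω a₂ a₃))

variable (ends : E → Sym2 V) (o a₁ a₂ a₃ b : V)

omit [Fintype E] [DecidableEq E] in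
/-- `1_Q` through the state. -/
lemma iQ_eq_st (ω : Config E) :
    iQ ends a₁ a₂ ω = ((qB (st ends o a₁ a₂ a₃ b ω) : ℤ) : R) := by
  unfold iQ qB st St.q'
  simp only [Set.indicator_apply, mem_avoidAll, Finset.mem_singleton, forall_eq, Pi.one_apply]
  by_cases h : Conn ends ω a₂ a₁ <;> simp [h]

omit [Fintype E] [DecidableEq E] in
/-- `1_PD` through the state. -/
lemma iPD_eq_st (ω : Config E) :
    iPD ends a₁ a₂ a₃ ω = ((pdB (st ends o a₁ a₂ a₃ b ω) : ℤ) : R) := by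
  unfold iPD pdB st St.q' St.L3 St.H3
  have e1 : Conn ends ω a₁ a₂ ↔ Conn ends ω a₂ a₁ := ⟨conn_symm, conn_symm⟩
  have e2 : Conn ends ω a₃ a₁ ↔ Conn ends ω a₁ a₃ := ⟨conn_symm, conn_symm⟩
  have e3 : Conn ends ω a₃ a₂ ↔ Conn ends ω a₂ a₃ := ⟨conn_symm, conn_symm⟩
  simp only [Set.indicator_apply, PDEvent, Dtilde, UnionCluster.inU, Set.mem_inter_iff,
    Set.mem_compl_iff, Set.mem_union, mem_connEvent, not_or, e1, e2, e3, Pi.one_apply]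
  by_cases h1 : Conn ends ω a₂ a₁ <;> by_cases h2 : Conn ends ω a₁ a₃ <;>
    by_cases h3 : Conn ends ω a₂ a₃ <;> simp [h1, h2, h3]

omit [Fintype E] [DecidableEq E] in
/-- `1_{v ∈ C(a₁)}` as a decided indicator. -/
lemma iL_eq_dec (v : V) (ω : Config E) :
    iL ends a₁ v ω = ((if decide (Conn ends ω a₁ v) then 1 else 0 : ℤ) : R) := by
  unfold iL
  simp only [Set.indicator_apply, mem_connEvent, Pi.one_apply]
  by_cases h : Conn ends ω a₁ v <;> simp [h]

omit [Fintype E] [DecidableEq E] in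
/-- `1_{v ∈ C(a₂)}` as a decided indicator. -/
lemma iH_eq_dec (v : V) (ω : Config E) :
    iH ends a₂ v ω = ((if decide (Conn ends ω a₂ v) then 1 else 0 : ℤ) : R) := by
  unfold iH
  simp only [Set.indicator_apply, mem_connEvent, Pi.one_apply]
  by_cases h : Conn ends ω a₂ v <;> simp [h]

omit [Fintype E] [DecidableEq E] in
/-- **`K₃` on states.** -/
theorem K3_eq_KB (x y z : Config E) :
    K3 ends o a₁ a₂ a₃ b x y z =
      ((KB (st ends o a₁ a₂ a₃ b x) (st ends o a₁ a₂ a₃ b y) (st ends o a₁ a₂ a₃ b z) : ℤ) : R) := by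
  unfold K3 sepKernel
  simp only [Fin.sum_univ_succ, Fin.sum_univ_zero, Matrix.cons_val_zero, Matrix.cons_val_succ,
    add_zero]
  unfold f3 f4 f5 f6 f7 f10 f11 f12 sigma inU
  simp only [iQ_eq_st ends o a₁ a₂ a₃ b, iPD_eq_st ends o a₁ a₂ a₃ b, iL_eq_dec, iH_eq_dec]
  unfold KB qB pdB sigB uB st St.q' St.Lo St.Ho St.Lb St.Hb St.L3 St.H3
  push_cast
  ring

end Bridge

/-! ## The theorem -/

section Main

open Classical

variable {V : Type*} {E : Type*} [Fintype E] [DecidableEq E] {R : Type*} [Field R]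
variable (ends : E → Sym2 V) (o a₁ a₂ a₃ b : V)

omit [Fintype E] in
/-- The one-sided merge relation holds between the states of `ω` and `ω[e ↦ open]` when `Q`
holds after opening. -/
lemma relB_st_update (e : E) (ω : Config E) (hQ : ¬ Conn ends (Function.update ω e true) a₂ a₁) :
    relB (st ends o a₁ a₂ a₃ b ω) (st ends o a₁ a₂ a₃ b (Function.update ω e true)) = true := by
  obtain ⟨⟨u, w⟩, huw⟩ := Quot.exists_rep (ends e)
  have hends : ends e = s(u, w) := huw.symm
  have hmono : ∀ {x y : V}, Conn ends ω x y → Conn ends (Function.update ω e true) x y :=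
    fun h => conn_mono (OneEdge.le_update_true ω e) h
  have hQ0 : ¬ Conn ends ω a₂ a₁ := fun h => hQ (hmono h)
  have hQ' : ¬ Conn ends (Function.update ω e true) a₁ a₂ := fun h => hQ (conn_symm h)
  -- consistency: a vertex in both root clusters joins the roots
  have cons : ∀ (ω' : Config E), ¬ Conn ends ω' a₂ a₁ → ∀ v, Conn ends ω' a₁ v → Conn ends ω' a₂ v → False :=
    fun ω' hq v h1 h2 => hq (conn_trans h2 (conn_symm h1))
  have c0 := cons ω hQ0
  have c1 := cons _ hQ
  have disj : ∀ {P Q : Prop}, (P → Q → False) → (¬ P ∨ ¬ Q) := fun {P Q} h =>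
    if hp : P then Or.inr (fun hq => h hp hq) else Or.inl hp
  have tri : ∀ {P P' Q : Prop}, (P → ¬ P' → ¬ Q) → ((¬ P ∨ P') ∨ ¬ Q) := fun {P P' Q} h =>
    if h1 : P then (if h2 : P' then Or.inl (Or.inr h2) else Or.inr (h h1 h2)) else Or.inl (Or.inl h1)
  rcases OneEdge.conn_update_true_cases hends ω hQ' with ⟨hH, hL1, hL2⟩ | ⟨hL, hH1, hH2⟩
  · simp only [relB, st, St.q', St.Lo, St.Ho, St.Lb, St.Hb, St.L3, St.H3, hH, Bool.and_eq_true,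
      Bool.or_eq_true, Bool.not_eq_true', decide_eq_true_eq, decide_eq_false_iff_not, beq_iff_eq]
    exact ⟨⟨⟨⟨⟨⟨⟨⟨hQ0, hQ0⟩, disj (c0 o)⟩, disj (c0 b)⟩, disj (c0 a₃)⟩,
      disj (fun h1 h2 => c1 o h1 ((hH o).2 h2))⟩, disj (fun h1 h2 => c1 b h1 ((hH b).2 h2))⟩,
      disj (fun h1 h2 => c1 a₃ h1 ((hH a₃).2 h2))⟩,
      Or.inl ⟨⟨⟨⟨⟨⟨⟨⟨trivial, trivial⟩, trivial⟩, imp_iff_not_or.mp (hL1 o)⟩,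
        imp_iff_not_or.mp (hL1 b)⟩, imp_iff_not_or.mp (hL1 a₃)⟩, tri (hL2 o)⟩, tri (hL2 b)⟩,
        tri (hL2 a₃)⟩⟩
  · simp only [relB, st, St.q', St.Lo, St.Ho, St.Lb, St.Hb, St.L3, St.H3, hL, Bool.and_eq_true,
      Bool.or_eq_true, Bool.not_eq_true', decide_eq_true_eq, decide_eq_false_iff_not, beq_iff_eq]
    exact ⟨⟨⟨⟨⟨⟨⟨⟨hQ0, hQ⟩, disj (c0 o)⟩, disj (c0 b)⟩, disj (c0 a₃)⟩,
      disj (fun h1 h2 => c1 o ((hL o).2 h1) h2)⟩, disj (fun h1 h2 => c1 b ((hL b).2 h1) h2)⟩,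
      disj (fun h1 h2 => c1 a₃ ((hL a₃).2 h1) h2)⟩,
      Or.inr ⟨⟨⟨⟨⟨⟨⟨⟨trivial, trivial⟩, trivial⟩, imp_iff_not_or.mp (hH1 o)⟩,
        imp_iff_not_or.mp (hH1 b)⟩, imp_iff_not_or.mp (hH1 a₃)⟩, tri (hH2 o)⟩, tri (hH2 b)⟩,
        tri (hH2 a₃)⟩⟩

/-- **One typed edge never contributes**: for the kernel `K₃`, the typed three-copy count with a
single typed edge vanishes, for every pinned configuration and both types. -/
theorem typedCount_singleton_K3 (e : E) (z : Config E) (τ : E → ℕ) (hτ : τ e = 1 ∨ τ e = 2) :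
    typedCount {e} z τ (K3 ends o a₁ a₂ a₃ b : Config E → Config E → Config E → R) = 0 := by
  rw [typedCount_singleton]
  have hzp : Function.update z e true = Function.update (Function.update z e false) e true := by
    rw [Function.update_idem]
  simp only [Fintype.sum_bool, Bool.toNat_true, Bool.toNat_false]
  rw [hzp]
  set zm := Function.update z e false with hzm
  set zp := Function.update zm e true with hzp'
  simp only [K3_eq_KB ends o a₁ a₂ a₃ b]
  by_cases hQ : Conn ends zp a₂ a₁
  · have hq : (st ends o a₁ a₂ a₃ b zp).q' = true := by simp [st, St.q', hQ]
    rcases hτ with h | h <;> simp only [h] <;> norm_num <;>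
      simp [KB_eq_zero_of_q' _ _ _ (Or.inl hq), KB_eq_zero_of_q' _ _ _ (Or.inr (Or.inl hq)),
        KB_eq_zero_of_q' _ _ _ (Or.inr (Or.inr hq))]
  · have key := merge_identity _ _ (relB_st_update ends o a₁ a₂ a₃ b e zm hQ)
    set sm := st ends o a₁ a₂ a₃ b zm with hsm
    set sp := st ends o a₁ a₂ a₃ b zp with hsp
    rcases hτ with h | h <;> simp only [h] <;> norm_num
    · have h0 : KB sp sm sm + (KB sm sp sm + KB sm sm sp) = 0 := by linarith [key.1]
      have h1 : ((KB sp sm sm + (KB sm sp sm + KB sm sm sp) : ℤ) : R) = 0 := by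
        rw [h0, Int.cast_zero]
      push_cast at h1
      exact h1
    · have h0 : KB sp sp sm + KB sp sm sp + KB sm sp sp = 0 := by linarith [key.2]
      have h1 : ((KB sp sp sm + KB sp sm sp + KB sm sp sp : ℤ) : R) = 0 := by
        rw [h0, Int.cast_zero]
      push_cast at h1
      exact h1

end Main

/-! ## Corollaries: the empty typed count and the weighted one-fractional-edge statement -/

section Corollaries

open Classical

variable {V : Type*} {E : Type*} [Fintype E] [DecidableEq E] {R : Type*} [Field R]
  [LinearOrder R] [IsStrictOrderedRing R]
variable (ends : E → Sym2 V) (o a₁ a₂ a₃ b : V)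

omit [LinearOrder R] [IsStrictOrderedRing R] in
/-- With no typed edge the typed count is the kernel on the diagonal. -/
lemma typedCount_empty (z : Config E) (τ : E → ℕ) (K : Config E → Config E → Config E → R) :
    typedCount ∅ z τ K = K z z z := by
  unfold typedCount
  have hcond : ∀ x y w : Config E,
      ((∀ e, e ∉ (∅ : Finset E) → x e = z e ∧ y e = z e ∧ w e = z e) ∧
        (∀ e ∈ (∅ : Finset E), openCount x y w e = τ e)) ↔ (x = z ∧ (y = z ∧ w = z)) := by
    intro x y w
    constructor
    · rintro ⟨h1, _⟩
      exact ⟨funext fun e => (h1 e (Finset.notMem_empty e)).1,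
        funext fun e => (h1 e (Finset.notMem_empty e)).2.1,
        funext fun e => (h1 e (Finset.notMem_empty e)).2.2⟩
    · rintro ⟨rfl, rfl, rfl⟩
      exact ⟨fun e _ => ⟨rfl, rfl, rfl⟩, fun e he => absurd he (Finset.notMem_empty e)⟩
  simp only [hcond, ite_and, sum_ite_const]
  rw [Finset.sum_ite_eq' Finset.univ z]
  simp only [Finset.mem_univ, if_true]
  rw [Finset.sum_ite_eq' Finset.univ z]
  simp only [Finset.mem_univ, if_true]
  rw [Finset.sum_ite_eq' Finset.univ z]
  simp

omit [Fintype E] [DecidableEq E] [LinearOrder R] [IsStrictOrderedRing R] in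
/-- The kernel vanishes on the diagonal (deterministic configurations carry no covariance). -/
lemma K3_diag (z : Config E) : K3 ends o a₁ a₂ a₃ b z z z = (0 : R) := by
  rw [K3_eq_KB]
  have h : ∀ s : St, KB s s s = 0 := by decide +kernel
  rw [h, Int.cast_zero]

/-- **The covariance form vanishes along every single-edge line**: if every edge but `e` carries a
deterministic weight, `Gc = D · P(Q) · G` is `0` whatever the weight of `e`. -/
theorem Gc_eq_zero_of_one_fractional (p : E → R) (e : E)
    (hp : ∀ e', e' ≠ e → p e' = 0 ∨ p e' = 1) : Gc p ends o a₁ a₂ a₃ b = 0 := by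
  rw [hcov_cubic p ends o a₁ a₂ a₃ b (fun _ => 0),
    triSum_pin p (Finset.notMem_empty e) (fun _ => 0) (K3 ends o a₁ a₂ a₃ b)]
  have hq : ∀ c : R, c = 0 ∨ c = 1 → ∀ e', e' ∉ (∅ : Finset E) →
      Function.update p e c e' = 0 ∨ Function.update p e c e' = 1 := by
    intro c hc e' _
    by_cases h : e' = e
    · subst h; simpa using hc
    · rw [Function.update_of_ne h]; exact hp e' h
  have hpe : ∀ e', e' ∉ ({e} : Finset E) → p e' = 0 ∨ p e' = 1 := by
    intro e' he'
    exact hp e' (by simpa using he')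
  simp only [Finset.insert_empty]
  rw [triSum_pinned_eq _ ∅ (hq 0 (Or.inl rfl)), triSum_pinned_eq _ ∅ (hq 1 (Or.inr rfl)),
    triSum_pinned_eq p {e} hpe,
    triSum_pinned_eq p {e} hpe, typedCount_empty, typedCount_empty, K3_diag, K3_diag,
    typedCount_singleton_K3 ends o a₁ a₂ a₃ b e _ _ (Or.inl (by simp)),
    typedCount_singleton_K3 ends o a₁ a₂ a₃ b e _ _ (Or.inr (by simp))]
  ring

end Corollaries

end OneTyped

end CovForm

end Summit.Ventures.PercRepro2
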